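/-
Copyright (c) 2026. All rights reserved.
Released under Apache 2.0 license as described in the file LICENSE.
-/
import Literature.Probability.FitznerVanDerHofstad2017.NobleBoundsNJointKitTZ
import Literature.Probability.FitznerVanDerHofstad2017.NobleBoundsNFirstEProper
import Literature.Probability.FitznerVanDerHofstad2017.NobleBoundsNEndC1
import HarnessLib

/-!
# Fitzner–van der Hofstad (2017), §6.1 (6.4)–(6.10) / (5.4) / App. B Table `B^{(2),ι,a,b}`: the FIRST junction, variant `F″` proper, inner class `1` — the rows `(a, ≥2 | d = 1)` behind the start letter `P^{S,a}`

[FvdH17] = R. Fitzner, R. van der Hofstad, *Mean-field behavior for nearest-neighbor percolation in `d > 10`*,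
arXiv:1506.07977v2 (EJP 22 (2017), paper 43).  Page numbers refer to the arXiv version.

First-junction (`k = 0`) copies of the `d = 1` rows of `B^{(2)}` (the companion of `NobleBoundsNFirstEProper`,
which does the refund-free rows `d ≥ 2`).  Level `1` is of kind `midE` with `t_0 ≠ u_1` (`F″` proper, (4.58)/(4.60),
p. 41) and the last sausage of level `1` is an OPEN BOND: inner class `1` (`t_0 ∼ z_0`, `{t_0,z_0}` open; by
`Conds.tzNF` the joint witness of the line `t_0 ⇔ z_0`, slot `2`, is the bond itself).  As in [FvdH17] §6.1
"Case b = 1" (p. 59) the bond is read twice — in the TRIANGLE `t_0 → u_1 → z_0 ←1̲→ t_0` on level `1` and in the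
two-level PENTAGON `u_0 ←1̲→ b̄_0 → w_1 → t_0 ←1̲→ z_0 → w_0` (bond `b_0`, `E₁`, `E₂`, the bond again on the
sausage-bond pseudo-line `xtz` of `NobleBoundsNJointKitTZ`, the exit line of the start level) — and the second
reading is refunded by the factor `p⁻¹`; the three start lines `0 → u_0`, `0 → w_0`, `w_0 → u_0` form the start
letter `P^{S,a}(u_0,w_0)` of `NobleBoundsNFirstSOpen.first_startLetter_gl` ((6.5)–(6.10)).  Targets: `P^{S,a}(u_0,w_0)`
times the `d = 1` summand of row `(a, ≥2)` of `B^{(2),κ,a,b}` (App. B Table p. 76, base-`u` reading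
`NobleBlocksNTPrime.blockBNTpt₀'`, DIVERGENCE D76 of the b2b-lace packet):

* rows `(a, ≥2 | d = 1)`, every `a`: `p⁻¹ · 2dD(z−t) · T_{≥1,≥1,1̲}(y−t, z−t, 0) · P_{1̲,≥0,≥1,1̲,≥0}(e, x, t, z, v)`
  (row `1` carries the extra indicator `2dD(v)`, `= 1` on the piece);
* row `(0, ≥2 | d = 1)` sharper (`w_0 = u_0`, exit line `u_0 → z_0` of length `≥ 1`):
  `δ_{v,0} (1−δ_{v,z}) · p⁻¹ · 2dD(z−t) · T_{≥1,≥1,1̲}(y−t, z−t, 0) · P_{1̲,≥0,≥1,1̲,≥1}(e, x, t, z, 0)`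

(printed `0 = u_0`, `e = b̄_0 − u_0`, `v = w_0 − u_0`, `x = w_1 − u_0`, `y = u_1 − u_0`).

§A grouping `glFirstPT` and events `firstEvST`; §B readings; §C parameter facts; §D the core; §E the cells in
absolute coordinates and their literal base-`u_0` forms `…_lit`.

Conventions: `d`-generic; nothing is cited as a fact; additive (no existing declaration is changed).
-/

noncomputable section

namespace Literature.Probability.FitznerVanDerHofstad2017

open Literature.Barriers.CriticalPhenomena Literature.Probability.Percolation
open Literature.Probability.LatticeModels Literature.Combinatorics.SimpleGraph _root_.SimpleGraph
open _root_.MeasureTheory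
open Literature.Probability.FitznerVanDerHofstad2017.NobleBlocks
open Literature.Probability.FitznerVanDerHofstad2017.NobleBlocks.LenIdx
open scoped ENNReal

variable {d : ℕ}

/-! ### A. The grouping and the events -/

/-- The GROUPING of the first-junction `F″`-proper rows `d = 1`: letter `lo 0` = the three start slots (the start
letter `P^{S,a}`), letter `xb` = {bond, `up 0`, `up 1`, `xtz`, `lo 3`} (the pentagon `P_{1̲,≥0,≥1,1̲,·}`), letter
`up 2` = {`up 2`, `up 3`, `up 4`} (the triangle `T_{≥1,≥1,1̲}` through the open sausage bond).
[cite: FitznerVanDerHofstad2017, App. B Table "B^{(2),ι,a,b}", rows b ≥ 2, d = 1 (arXiv:1506.07977v2 p. 76); §6.1 (6.5)–(6.10), "Case b = 1" (pp. 58–59)] -/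
def glFirstPT : JIdx → JIdx
  | .xb => .xb
  | .xtz => .xb
  | .lo j => ![JIdx.lo 0, .lo 0, .lo 0, .xb, .xb, .xb] j
  | .up j => ![JIdx.xb, .xb, .up 2, .up 2, .up 2, .up 5] j

/-- Events of the first-junction `d = 1` rows: those of `firstEvS` and the sausage-bond event `ET` on the
pseudo-line `xtz`. [cite: FitznerVanDerHofstad2017, §6.1 (6.4), "Case b = 1" (arXiv:1506.07977v2 pp. 58–59)] -/
def firstEvST (EB X0 X1 X2 X3 E0 E1 E2 E3 E4 ET : Set (BondConfig (Site d))) : JIdx → Set (BondConfig (Site d))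
  | .xtz => ET
  | i => firstEvS EB X0 X1 X2 X3 E0 E1 E2 E3 E4 i

section Grouping

variable (M : ℕ) (x : Site d) (b : Fin (M + 2) → Site d × Site d) (w t z : Fin (M + 2) → Site d)
  (a : Fin (M + 2) → Fin 3 ⊕ Unit) (τ : Fin (M + 1) → Bool × Fin 3)

/-- **The grouping `glFirstPT` obeys the (4.65) rule over a `midE` level `1`**: its cross-level letter joins
start-level lines with the ENTRY slots `0, 1` of level `1`.
[cite: FitznerVanDerHofstad2017, §4.4 (4.65) and the sentence after it (arXiv:1506.07977v2 p. 43)] -/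
theorem glFirstPT_entry_midE (hσ : (τ 0).1 = true) {a' : Fin 3} (ha' : a (0 : Fin (M + 1)).succ = Sum.inl a')
    (j j' : Fin 6) (hg : glFirstPT (.lo j) = glFirstPT (.up j')) :
    IsEntry (pieceViews M x b w t z a τ (0 : Fin (M + 1)).castSucc.succ).kd j' := by
  rw [pieceViews_mid_kd, ha', hσ]
  show (j' : ℕ) < 3
  fin_cases j' <;> fin_cases j <;> simp [glFirstPT] at hg ⊢

/-- The letter of `xtz` under `glFirstPT` contains no upper slot `2` (the sausage line's own slot).
[cite: FitznerVanDerHofstad2017, §6.1 "Case b = 1" (arXiv:1506.07977v2 p. 59)] -/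
theorem glFirstPT_up_ne_two (j : Fin 6) (hg : glFirstPT (.up j) = glFirstPT .xtz) : j ≠ 2 := by
  fin_cases j <;> simp [glFirstPT] at hg ⊢

variable (EB X0 X1 X2 X3 E0 E1 E2 E3 E4 ET : Set (BondConfig (Site d)))

/-- [cite: FitznerVanDerHofstad2017, §6.1 (6.4) (arXiv:1506.07977v2 p. 58)] -/
theorem firstEvST_xb : firstEvST EB X0 X1 X2 X3 E0 E1 E2 E3 E4 ET .xb = EB := rfl

/-- [cite: FitznerVanDerHofstad2017, §6.1 (6.4) (arXiv:1506.07977v2 p. 58)] -/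
theorem firstEvST_xtz : firstEvST EB X0 X1 X2 X3 E0 E1 E2 E3 E4 ET .xtz = ET := rfl

/-- [cite: FitznerVanDerHofstad2017, §6.1 (6.4) (arXiv:1506.07977v2 p. 58)] -/
theorem firstEvST_up (j : Fin 6) :
    firstEvST EB X0 X1 X2 X3 E0 E1 E2 E3 E4 ET (.up j) = firstEvS EB X0 X1 X2 X3 E0 E1 E2 E3 E4 (.up j) := rfl

/-- [cite: FitznerVanDerHofstad2017, §6.1 (6.4) (arXiv:1506.07977v2 p. 58)] -/
theorem firstEvST_lo (j : Fin 6) :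
    firstEvST EB X0 X1 X2 X3 E0 E1 E2 E3 E4 ET (.lo j) = firstEvS EB X0 X1 X2 X3 E0 E1 E2 E3 E4 (.lo j) := rfl

variable {EB X0 X1 X2 X3 E0 E1 E2 E3 E4 ET} in
/-- The events are finitary if their data are. [cite: FitznerVanDerHofstad2017, §6.1 (6.4) (arXiv:1506.07977v2 p. 58)] -/
theorem isFinitary_firstEvST (hB : IsFinitary EB) (f0 : IsFinitary X0) (f1 : IsFinitary X1) (f2 : IsFinitary X2)
    (f3 : IsFinitary X3) (h0 : IsFinitary E0) (h1 : IsFinitary E1) (h2 : IsFinitary E2) (h3 : IsFinitary E3)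
    (h4 : IsFinitary E4) (hT : IsFinitary ET) (i : JIdx) :
    IsFinitary (firstEvST EB X0 X1 X2 X3 E0 E1 E2 E3 E4 ET i) := by
  cases i with
  | xtz => exact hT
  | xb => exact isFinitary_firstEvS _ _ _ _ _ _ _ _ _ _ hB f0 f1 f2 f3 h0 h1 h2 h3 h4 .xb
  | lo j => exact isFinitary_firstEvS _ _ _ _ _ _ _ _ _ _ hB f0 f1 f2 f3 h0 h1 h2 h3 h4 (.lo j)
  | up j => exact isFinitary_firstEvS _ _ _ _ _ _ _ _ _ _ hB f0 f1 f2 f3 h0 h1 h2 h3 h4 (.up j)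

end Grouping

/-! ### B. The readings of the pentagon and the triangle -/

section Letter

variable (p : unitInterval) (M : ℕ) (x : Site d) (b : Fin (M + 2) → Site d × Site d) (w t z : Fin (M + 2) → Site d)
  (a : Fin (M + 2) → Fin 3 ⊕ Unit) (τ : Fin (M + 1) → Bool × Fin 3)

/-- **Five-line reading of the pentagon letter `xb`** under `glFirstPT`: bond (level `0`), `b̄_0 → w_1`, `w_1 → t_0`
(level `1`), the sausage bond on the pseudo-line `xtz` (level `0`), the exit line of the start level (slot `3`).
[cite: FitznerVanDerHofstad2017, §4.2 (4.18) (arXiv:1506.07977v2 p. 35); App. B Table "B^{(2),ι,a,b}" rows d = 1 (p. 76); §6.1 "Case b = 1" (p. 59)] -/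
theorem junF_firstEPT_xb_le₅ (hσ : (τ 0).1 = true) {a' : Fin 3} (ha' : a (0 : Fin (M + 1)).succ = Sum.inl a')
    (EB X0 X1 X2 X3 E0 E1 E2 E3 E4 ET : Set (BondConfig (Site d))) :
    junF p M x b w t z a τ (0 : Fin (M + 1)).castSucc glFirstPT true true
        (firstEvST EB X0 X1 X2 X3 E0 E1 E2 E3 E4 ET) .xb ≤
      piPerc d p 2 (genDisjOcc ![EB, E0, E1, ET, X3] ![0, 1, 1, 0, 0]) := by
  refine junF_le_of_lines p M x b w t z a τ (0 : Fin (M + 1)).castSucc glFirstPT true true _ JIdx.xb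
    ![JIdx.xb, .up 0, .up 1, .xtz, .lo 3] (by decide) (fun m => ?_) ![0, 1, 1, 0, 0]
    (fun m => by fin_cases m <;> rfl) ![EB, E0, E1, ET, X3] (by funext m; fin_cases m <;> rfl)
  fin_cases m
  · exact ⟨rfl, rfl⟩
  · exact ⟨(jMidE_act_up_iff M x b w t z a τ 0 hσ ha' true true 0).2 (by decide), rfl⟩
  · exact ⟨(jMidE_act_up_iff M x b w t z a τ 0 hσ ha' true true 1).2 (by decide), rfl⟩
  · exact ⟨rfl, rfl⟩
  · exact ⟨(jFirst_act_lo_iff M x b w t z a τ true true 3).2 (by decide), rfl⟩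

/-- **Three-line reading of the triangle letter `up 2`** under `glFirstPT`: `t_0 → u_1` (slot `3`), `u_1 → z_0`
(slot `4` backwards), `z_0 ←1̲→ t_0` (the sausage line, slot `2`, backwards), all on level `1`.
[cite: FitznerVanDerHofstad2017, §4.2 (4.17) (arXiv:1506.07977v2 p. 35); App. B Table "B^{(2),ι,a,b}" rows d = 1 (p. 76)] -/
theorem junF_firstEPT_up_le₃ (hσ : (τ 0).1 = true) {a' : Fin 3} (ha' : a (0 : Fin (M + 1)).succ = Sum.inl a')
    (EB X0 X1 X2 X3 E0 E1 E2 E3 E4 ET : Set (BondConfig (Site d))) :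
    junF p M x b w t z a τ (0 : Fin (M + 1)).castSucc glFirstPT true true
        (firstEvST EB X0 X1 X2 X3 E0 E1 E2 E3 E4 ET) (.up 2) ≤
      piPerc d p 2 (genDisjOcc ![E3, E4, E2] ![1, 1, 1]) := by
  refine junF_le_of_lines p M x b w t z a τ (0 : Fin (M + 1)).castSucc glFirstPT true true _ (JIdx.up 2)
    ![JIdx.up 3, .up 4, .up 2] (by decide) (fun m => ?_) ![1, 1, 1] (fun m => by fin_cases m <;> rfl)
    ![E3, E4, E2] (by funext m; fin_cases m <;> rfl)
  fin_cases m
  · exact ⟨(jMidE_act_up_iff M x b w t z a τ 0 hσ ha' true true 3).2 (by decide), rfl⟩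
  · exact ⟨(jMidE_act_up_iff M x b w t z a τ 0 hσ ha' true true 4).2 (by decide), rfl⟩
  · exact ⟨(jMidE_act_up_iff M x b w t z a τ 0 hσ ha' true true 2).2 (by decide), rfl⟩

end Letter

/-! ### C. The parameter facts -/

section ProperFacts

variable {M : ℕ} {x : Site d} {b : Fin (M + 2) → Site d × Site d} {w t z : Fin (M + 2) → Site d}
  {a : Fin (M + 2) → Fin 3 ⊕ Unit} {c : Fin 3 ⊕ Unit} {τ : Fin (M + 1) → Bool × Fin 3}
  {ω : Fin (M + 3) → BondConfig (Site d)} {K₀ : Fin (M + 3) → Fin 6 → Set (Sym2 (Site d))}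

variable (M x b w t z a c τ) in
/-- The PARAMETER FACTS of a non-empty first-junction `F″`-proper piece of inner class `1`: those of
`firstECut_facts` together with `t_0 ∼ z_0` and the OPEN sausage bond.
[cite: FitznerVanDerHofstad2017, (4.57)–(4.60), (4.64) and §6.1 "Case b = 1" (arXiv:1506.07977v2 pp. 41–42, 59)] -/
theorem firstEProperTZ_facts (hF : JFacts M x b w t z a c τ ω K₀) (hσ : (τ 0).1 = true) {a₀ a' : Fin 3}
    (ha : a (0 : Fin (M + 1)).castSucc = Sum.inl a₀) (ha' : a (0 : Fin (M + 1)).succ = Sum.inl a')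
    (hty : t (0 : Fin (M + 1)).castSucc ≠ (b (0 : Fin (M + 1)).succ).1) (hc1 : (τ 0).2 = 1) :
    (a' = 2 ∧ z (0 : Fin (M + 1)).castSucc ≠ (b (0 : Fin (M + 1)).succ).1 ∧
      w (0 : Fin (M + 1)).succ ≠ t (0 : Fin (M + 1)).castSucc ∧
      (b (0 : Fin (M + 1)).castSucc).1 ≠ t (0 : Fin (M + 1)).castSucc ∧
      (b (0 : Fin (M + 1)).castSucc).1 ≠ w (0 : Fin (M + 1)).succ ∧
      (b (0 : Fin (M + 1)).castSucc).1 ≠ z (0 : Fin (M + 1)).castSucc ∧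
      (b (0 : Fin (M + 1)).castSucc).2 ≠ z (0 : Fin (M + 1)).castSucc ∧
      ((b (0 : Fin (M + 1)).castSucc).1 = 0 → w (0 : Fin (M + 1)).castSucc = 0) ∧
      (a₀ = 0 → w (0 : Fin (M + 1)).castSucc = (b (0 : Fin (M + 1)).castSucc).1) ∧
      (a₀ = 1 → (zdGraph d).Adj (b (0 : Fin (M + 1)).castSucc).1 (w (0 : Fin (M + 1)).castSucc)) ∧
      (a₀ = 2 → (b (0 : Fin (M + 1)).castSucc).1 ≠ w (0 : Fin (M + 1)).castSucc)) ∧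
    t (0 : Fin (M + 1)).castSucc ≠ z (0 : Fin (M + 1)).castSucc ∧
    (zdGraph d).Adj (t (0 : Fin (M + 1)).castSucc) (z (0 : Fin (M + 1)).castSucc) ∧
    s(t (0 : Fin (M + 1)).castSucc, z (0 : Fin (M + 1)).castSucc) ∈ ω (0 : Fin (M + 1)).castSucc.succ :=
  ⟨firstECut_facts M x b w t z a c τ hF hσ ha ha' hty, (hF.innerClass_one 0 hc1).1, (hF.innerClass_one 0 hc1).2.2,
    (hF.innerClass_one 0 hc1).2.1⟩

/-- `2dD(v − u) = 1` for lattice neighbours `u ∼ v`. [cite: FitznerVanDerHofstad2017, §3.5 "D(x) = 𝟙{|x| = 1}/(2d)" (arXiv:1506.07977v2 p. 32)] -/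
theorem twoDD_sub_eq_one_of_adj {u v : Site d} (h : (zdGraph d).Adj u v) : twoDD (v - u) = 1 := by
  obtain ⟨ι, hι⟩ := (zdGraph_adj_iff_stepVec u v).1 h
  rw [hι, add_sub_cancel_left, twoDD_stepVec]

end ProperFacts

/-! ### D. The core -/

section Packages

variable (p : unitInterval) (M : ℕ) (x : Site d) (b : Fin (M + 2) → Site d × Site d) (w t z : Fin (M + 2) → Site d)
  (a : Fin (M + 2) → Fin 3 ⊕ Unit) (c : Fin 3 ⊕ Unit) (τ : Fin (M + 1) → Bool × Fin 3)

/-- **Core of the first-junction `d = 1` rows**: start-letter data (events `X0, X1, X2` of the three start lines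
and a bound `T₀` of the letter `lo 0`), events for the exit line of the start level and the five lines of level `1`
containing the joint witnesses, the bond events of `b_0` (on `xb`) and of `{t_0,z_0}` (on `xtz`), bounds `Y₁` of the
pentagon and `Y₂` of the triangle give a package with target `T₀ · (p⁻¹ · Y₂ · Y₁)` — the factor `p` of the
sausage-bond pseudo-line is refunded because the pentagon letter contains the bond line `{b_0}`.
[cite: FitznerVanDerHofstad2017, §6.1 (6.4)–(6.10), "Case b = 1", "we extract a factor p" (arXiv:1506.07977v2 pp. 58–59); §4.4 (4.57)–(4.60), (4.65) (pp. 41, 43)] -/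
theorem nonempty_jPkg_firstEPT_core (hσ : (τ 0).1 = true) (hc1 : (τ 0).2 = 1) {a' : Fin 3}
    (ha' : a (0 : Fin (M + 1)).succ = Sum.inl a') (X0 X1 X2 X3 E0 E1 E2 E3 E4 : Set (BondConfig (Site d)))
    (f0 : IsFinitary X0) (f1 : IsFinitary X1) (f2 : IsFinitary X2) (f3 : IsFinitary X3) (h0 : IsFinitary E0)
    (h1 : IsFinitary E1) (h2 : IsFinitary E2) (h3 : IsFinitary E3) (h4 : IsFinitary E4)
    (hB : ({s((b (0 : Fin (M + 1)).castSucc).1, (b (0 : Fin (M + 1)).castSucc).2)} : Set (Sym2 (Site d))) ∈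
      (event (eq 1) (b (0 : Fin (M + 1)).castSucc).1 (b (0 : Fin (M + 1)).castSucc).2 : Set (BondConfig (Site d))))
    (hT : ({s(t (0 : Fin (M + 1)).castSucc, z (0 : Fin (M + 1)).castSucc)} : Set (Sym2 (Site d))) ∈
      (event (eq 1) (t (0 : Fin (M + 1)).castSucc) (z (0 : Fin (M + 1)).castSucc) : Set (BondConfig (Site d))))
    (he : s((b (0 : Fin (M + 1)).castSucc).1, (b (0 : Fin (M + 1)).castSucc).2) ∈ (zdGraph d).edgeSet)
    (hmem : ∀ ω K₀, JFacts M x b w t z a c τ ω K₀ →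
      K₀ (0 : Fin (M + 1)).castSucc.castSucc 0 ∈ X0 ∧ K₀ (0 : Fin (M + 1)).castSucc.castSucc 1 ∈ X1 ∧
        K₀ (0 : Fin (M + 1)).castSucc.castSucc 2 ∈ X2 ∧ K₀ (0 : Fin (M + 1)).castSucc.castSucc 3 ∈ X3 ∧
        K₀ (0 : Fin (M + 1)).castSucc.succ 0 ∈ E0 ∧ K₀ (0 : Fin (M + 1)).castSucc.succ 1 ∈ E1 ∧
        K₀ (0 : Fin (M + 1)).castSucc.succ 2 ∈ E2 ∧ K₀ (0 : Fin (M + 1)).castSucc.succ 3 ∈ E3 ∧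
        K₀ (0 : Fin (M + 1)).castSucc.succ 4 ∈ E4)
    {T₀ Y₁ Y₂ : ℝ≥0∞}
    (hrow₀ : junF p M x b w t z a τ (0 : Fin (M + 1)).castSucc glFirstPT true true
      (firstEvST (event (eq 1) (b (0 : Fin (M + 1)).castSucc).1 (b (0 : Fin (M + 1)).castSucc).2) X0 X1 X2 X3
        E0 E1 E2 E3 E4 (event (eq 1) (t (0 : Fin (M + 1)).castSucc) (z (0 : Fin (M + 1)).castSucc))) (.lo 0) ≤ T₀)
    (hY₁ : piPerc d p 2 (genDisjOcc
      ![(event (eq 1) (b (0 : Fin (M + 1)).castSucc).1 (b (0 : Fin (M + 1)).castSucc).2 : Set (BondConfig (Site d))),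
        E0, E1, event (eq 1) (t (0 : Fin (M + 1)).castSucc) (z (0 : Fin (M + 1)).castSucc), X3]
      ![0, 1, 1, 0, 0]) ≤ Y₁)
    (hY₂ : piPerc d p 2 (genDisjOcc ![E3, E4, E2] ![1, 1, 1]) ≤ Y₂) :
    Nonempty (JPkg p (jctx M x b w t z a τ (0 : Fin (M + 1)).castSucc) (JFacts M x b w t z a c τ)
      (T₀ * ((ENNReal.ofReal p)⁻¹ * Y₂ * Y₁))) := by
  refine nonempty_jPkg_of_joint_tz p (0 : Fin (M + 1)).castSucc glFirstPT true
    (firstEvST (event (eq 1) (b (0 : Fin (M + 1)).castSucc).1 (b (0 : Fin (M + 1)).castSucc).2) X0 X1 X2 X3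
      E0 E1 E2 E3 E4 (event (eq 1) (t (0 : Fin (M + 1)).castSucc) (z (0 : Fin (M + 1)).castSucc)))
    (isFinitary_firstEvST (isFinitary_event _ _ _) f0 f1 f2 f3 h0 h1 h2 h3 h4 (isFinitary_event _ _ _))
    (fun _ => hB) hT (fun ω K₀ hF => hF.tz_facts_of_innerClass_one 0 hc1)
    (fun _ ω K₀ hF => hF.bK_ne_tzB_midE 0 hσ ha')
    (fun j j' _ _ hg => glFirstPT_entry_midE M x b w t z a τ hσ ha' j j' hg)
    (htzU_of_midE M x b w t z a c τ 0 hσ ha' hc1 glFirstPT true glFirstPT_up_ne_two)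
    (fun ω K₀ hF => ⟨fun j hj => ?_, fun j hj => ?_⟩) ?_
  · have hj4 : (j : ℕ) < 4 := (jFirst_act_lo_iff M x b w t z a τ true true j).1 hj
    obtain ⟨m0, m1, m2, m3, -⟩ := hmem ω K₀ hF
    rw [firstEvST_lo]
    exact mem_firstEvS_lo _ _ _ _ _ _ _ _ _ _ m0 m1 m2 m3 j hj4
  · have hj5 : j ≠ 5 := (jMidE_act_up_iff M x b w t z a τ 0 hσ ha' true true j).1 hj
    obtain ⟨-, -, -, -, m0, m1, m2, m3, m4⟩ := hmem ω K₀ hF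
    rw [firstEvST_up]
    exact mem_firstEvS_up _ _ _ _ _ _ _ _ _ _ m0 m1 m2 m3 m4 j hj5
  · -- the letter bound `∏ junF ≤ p · (T₀ · (p⁻¹ · Y₂ · Y₁))`
    have hA := junF_firstEPT_xb_le₅ p M x b w t z a τ hσ ha'
      (event (eq 1) (b (0 : Fin (M + 1)).castSucc).1 (b (0 : Fin (M + 1)).castSucc).2) X0 X1 X2 X3 E0 E1 E2 E3 E4
      (event (eq 1) (t (0 : Fin (M + 1)).castSucc) (z (0 : Fin (M + 1)).castSucc))
    have hB' := junF_firstEPT_up_le₃ p M x b w t z a τ hσ ha'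
      (event (eq 1) (b (0 : Fin (M + 1)).castSucc).1 (b (0 : Fin (M + 1)).castSucc).2) X0 X1 X2 X3 E0 E1 E2 E3 E4
      (event (eq 1) (t (0 : Fin (M + 1)).castSucc) (z (0 : Fin (M + 1)).castSucc))
    have hAp := piPerc_two_genDisjOcc_le_ofReal_of_bond p he
      ![(event (eq 1) (b (0 : Fin (M + 1)).castSucc).1 (b (0 : Fin (M + 1)).castSucc).2 : Set (BondConfig (Site d))),
        E0, E1, event (eq 1) (t (0 : Fin (M + 1)).castSucc) (z (0 : Fin (M + 1)).castSucc), X3]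
      ![0, 1, 1, 0, 0] 0 rfl
    refine (prod_junF_le₃ p M x b w t z a τ (0 : Fin (M + 1)).castSucc glFirstPT true true _
      (show JIdx.lo 0 ≠ JIdx.xb by decide) (show JIdx.lo 0 ≠ JIdx.up 2 by decide)
      (show JIdx.xb ≠ JIdx.up 2 by decide)).trans ?_
    rw [mul_assoc, mul_left_comm (ENNReal.ofReal p)]
    refine mul_le_mul' hrow₀ ((mul_le_mul' hA hB').trans ?_)
    rw [mul_assoc ((ENNReal.ofReal p)⁻¹), mul_comm Y₂ Y₁]
    exact le_ofReal_mul_inv_mul p ((mul_le_mul' hAp (piPerc_le_one p 2 _)).trans_eq (mul_one _))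
      (mul_le_mul' hY₁ hY₂)

/-! ### E. The cells -/

/-- **Rows `(a, ≥2 | d = 1)` of `B^{(2)}` at the FIRST junction behind `P^{S,a}`, every start class `a`** (the
common shape: exit line of the start level read as `z_0 → w_0` of length `≥ 0`, no extra indicator): for
`t_0 ≠ u_1` (`F″`), inner class `1`, a package with target `P^{S,a}(u_0,w_0) · (p⁻¹ · 2dD(z_0 − t_0) ·
T_{≥1,≥1,1̲}(u_1 − t_0, z_0 − t_0, 0) · P_{1̲,≥0,≥1,1̲,≥0}(b̄_0 − u_0, w_1 − u_0, t_0 − u_0, z_0 − u_0, w_0 − u_0))`;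
`a_1 ≤ 1`: empty piece.
[cite: FitznerVanDerHofstad2017, App. B Table "B^{(2),ι,a,b}", rows b ≥ 2, d_{C̃}(w,u) = 1 (arXiv:1506.07977v2 p. 76); §6.1 (6.5)–(6.10), "Case b = 1" (pp. 58–59); §5.1 (5.3)–(5.4) (pp. 46–48)] -/
theorem nonempty_jPkg_firstE_properTZ_any_two (κ : Fin d × Bool)
    (hb : (b (0 : Fin (M + 1)).castSucc).2 = (b (0 : Fin (M + 1)).castSucc).1 + stepVec κ) (hσ : (τ 0).1 = true)
    (hc1 : (τ 0).2 = 1) {a₀ : Fin 3} (ha : a (0 : Fin (M + 1)).castSucc = Sum.inl a₀) {a' : Fin 3}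
    (ha' : a (0 : Fin (M + 1)).succ = Sum.inl a') (hty : t (0 : Fin (M + 1)).castSucc ≠ (b (0 : Fin (M + 1)).succ).1) :
    Nonempty (JPkg p (jctx M x b w t z a τ (0 : Fin (M + 1)).castSucc) (JFacts M x b w t z a c τ)
      (blockPS (Letters.perc d p) a₀ (b (0 : Fin (M + 1)).castSucc).1 (w (0 : Fin (M + 1)).castSucc) *
        ((Letters.perc d p).p⁻¹ * twoDD (z (0 : Fin (M + 1)).castSucc - t (0 : Fin (M + 1)).castSucc) *
          (Letters.perc d p).T (ge 1) (ge 1) (eq 1) ((b (0 : Fin (M + 1)).succ).1 - t (0 : Fin (M + 1)).castSucc)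
            (z (0 : Fin (M + 1)).castSucc - t (0 : Fin (M + 1)).castSucc) 0 *
          (Letters.perc d p).P (eq 1) (ge 0) (ge 1) (eq 1) (ge 0)
            ((b (0 : Fin (M + 1)).castSucc).2 - (b (0 : Fin (M + 1)).castSucc).1)
            (w (0 : Fin (M + 1)).succ - (b (0 : Fin (M + 1)).castSucc).1)
            (t (0 : Fin (M + 1)).castSucc - (b (0 : Fin (M + 1)).castSucc).1)
            (z (0 : Fin (M + 1)).castSucc - (b (0 : Fin (M + 1)).castSucc).1)
            (w (0 : Fin (M + 1)).castSucc - (b (0 : Fin (M + 1)).castSucc).1)))) := by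
  -- exit class `a′ ≤ 1` above: the piece is empty (clause (8))
  by_cases h2 : a' = 2
  swap
  · exact nonempty_jPkg_of_sharp p c _ 0 hσ ha' h2 hty _
  subst h2
  -- degenerate parameters: the piece is empty
  by_cases hP : z (0 : Fin (M + 1)).castSucc ≠ (b (0 : Fin (M + 1)).succ).1 ∧
      w (0 : Fin (M + 1)).succ ≠ t (0 : Fin (M + 1)).castSucc ∧
      t (0 : Fin (M + 1)).castSucc ≠ z (0 : Fin (M + 1)).castSucc ∧
      (zdGraph d).Adj (t (0 : Fin (M + 1)).castSucc) (z (0 : Fin (M + 1)).castSucc) ∧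
      ((b (0 : Fin (M + 1)).castSucc).1 = 0 → w (0 : Fin (M + 1)).castSucc = 0) ∧
      (a₀ = 0 → w (0 : Fin (M + 1)).castSucc = (b (0 : Fin (M + 1)).castSucc).1) ∧
      (a₀ = 1 → (zdGraph d).Adj (b (0 : Fin (M + 1)).castSucc).1 (w (0 : Fin (M + 1)).castSucc)) ∧
      (a₀ = 2 → (b (0 : Fin (M + 1)).castSucc).1 ≠ w (0 : Fin (M + 1)).castSucc)
  swap
  · refine ⟨JPkg.vacuous p _ _ (fun ω K₀ hF => hP ?_) _⟩
    obtain ⟨⟨-, hzy, hwt, -, -, -, -, hcan, hw0, hw1, hw2⟩, htz, hadj, -⟩ :=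
      firstEProperTZ_facts M x b w t z a c τ hF hσ ha ha' hty hc1
    exact ⟨hzy, hwt, htz, hadj, hcan, hw0, hw1, hw2⟩
  obtain ⟨hzy, hwt, htz, hadj, hcan, hw0, hw1, hw2⟩ := hP
  have huv : (b (0 : Fin (M + 1)).castSucc).1 ≠ (b (0 : Fin (M + 1)).castSucc).2 := by
    rw [hb]; exact (zdGraph_adj_iff_stepVec _ _ |>.2 ⟨κ, rfl⟩).ne
  have he : s((b (0 : Fin (M + 1)).castSucc).1, (b (0 : Fin (M + 1)).castSucc).2) ∈ (zdGraph d).edgeSet :=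
    (SimpleGraph.mem_edgeSet _).2 ((zdGraph_adj_iff_stepVec _ _).2 ⟨κ, hb⟩)
  obtain ⟨X0, X1, X2, f0, f1, f2, hmem₀, hrow₀⟩ :=
    first_startLetter_gl p M x b w t z a c τ glFirstPT true true (.lo 0) rfl rfl rfl ha hcan hw0 hw1 hw2
  rw [twoDD_sub_eq_one_of_adj hadj, mul_one, perc_p]
  refine nonempty_jPkg_firstEPT_core p M x b w t z a c τ hσ hc1 ha' X0 X1 X2
    (event (ge 0) (z (0 : Fin (M + 1)).castSucc) (w (0 : Fin (M + 1)).castSucc))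
    (event (ge 0) (b (0 : Fin (M + 1)).castSucc).2 (w (0 : Fin (M + 1)).succ))
    (event (ge 1) (w (0 : Fin (M + 1)).succ) (t (0 : Fin (M + 1)).castSucc))
    (event (eq 1) (z (0 : Fin (M + 1)).castSucc) (t (0 : Fin (M + 1)).castSucc))
    (event (ge 1) (t (0 : Fin (M + 1)).castSucc) (b (0 : Fin (M + 1)).succ).1)
    (event (ge 1) (b (0 : Fin (M + 1)).succ).1 (z (0 : Fin (M + 1)).castSucc))
    f0 f1 f2 (isFinitary_event _ _ _) (isFinitary_event _ _ _) (isFinitary_event _ _ _) (isFinitary_event _ _ _)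
    (isFinitary_event _ _ _) (isFinitary_event _ _ _)
    (singleton_mem_event_eq_one huv) (singleton_mem_event_eq_one htz) he (fun ω K₀ hF => ?_)
    (hrow₀ _ rfl rfl rfl) ?_ ?_
  · obtain ⟨h0, h1, -, h3, h4⟩ := hF.conn_midE 0 hσ ha'
    obtain ⟨-, htz', -, hop⟩ := firstEProperTZ_facts M x b w t z a c τ hF hσ ha ha' hty hc1
    obtain ⟨-, -, h5⟩ := hF.conn_first
    refine ⟨(hmem₀ ω K₀ hF).1, (hmem₀ ω K₀ hF).2.1, (hmem₀ ω K₀ hF).2.2, ?_, ?_, ?_, ?_, ?_, ?_⟩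
    · rw [event_comm, event_ge]; exact mem_openConnGe_zero_of_mem h5
    · rw [event_ge]; exact mem_openConnGe_zero_of_mem h0
    · rw [event_ge]; exact mem_openConnGe_one_of_ne h1 hwt
    · rw [hF.tz_witness_midE 0 hσ ha' htz' hop, event_comm]
      exact singleton_mem_event_eq_one htz'
    · rw [event_ge]; exact mem_openConnGe_one_of_ne h3 hty
    · rw [event_comm, event_ge]; exact mem_openConnGe_one_of_ne h4 hzy
  · exact piPerc_genDisjOcc_le_P p (eq 1) (ge 0) (ge 1) (eq 1) (ge 0) _ _ _ _ _ _ _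
  · have hT' := piPerc_genDisjOcc_le_T p (ge 1) (ge 1) (eq 1) (t (0 : Fin (M + 1)).castSucc)
      (b (0 : Fin (M + 1)).succ).1 (z (0 : Fin (M + 1)).castSucc) (t (0 : Fin (M + 1)).castSucc)
      (![1, 1, 1] : Fin 3 → Fin 2)
    rwa [sub_self] at hT'

/-- **Row `(≥2, ≥2 | d = 1)` at the first junction in the literal base-`u_0` coordinates of
`NobleBlocksNTPrime.blockBNTpt₀'`** (first summand of `blockBNTpt₀'_two_two`), behind `P^{S,2}`:
`p⁻¹ · 2dD(z−t) · T_{≥1,≥1,1̲}(y−t, z−t, 0) · P_{1̲,≥0,≥1,1̲,≥0}(e_κ, x, t, z, v)`.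
[cite: FitznerVanDerHofstad2017, App. B Table "B^{(2),ι,a,b}", row a ≥ 2, b ≥ 2, d = 1 (arXiv:1506.07977v2 p. 76); §5.1 (5.4) (p. 48)] -/
theorem nonempty_jPkg_firstE_properTZ_two_two_lit (κ : Fin d × Bool)
    (hb : (b (0 : Fin (M + 1)).castSucc).2 = (b (0 : Fin (M + 1)).castSucc).1 + stepVec κ) (hσ : (τ 0).1 = true)
    (hc1 : (τ 0).2 = 1) (ha : a (0 : Fin (M + 1)).castSucc = Sum.inl 2) {a' : Fin 3}
    (ha' : a (0 : Fin (M + 1)).succ = Sum.inl a') (hty : t (0 : Fin (M + 1)).castSucc ≠ (b (0 : Fin (M + 1)).succ).1) :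
    Nonempty (JPkg p (jctx M x b w t z a τ (0 : Fin (M + 1)).castSucc) (JFacts M x b w t z a c τ)
      (blockPS (Letters.perc d p) 2 (b (0 : Fin (M + 1)).castSucc).1 (w (0 : Fin (M + 1)).castSucc) *
        ((Letters.perc d p).p⁻¹ *
            twoDD ((z (0 : Fin (M + 1)).castSucc - (b (0 : Fin (M + 1)).castSucc).1) -
              (t (0 : Fin (M + 1)).castSucc - (b (0 : Fin (M + 1)).castSucc).1)) *
          (Letters.perc d p).T (ge 1) (ge 1) (eq 1)
            (((b (0 : Fin (M + 1)).succ).1 - (b (0 : Fin (M + 1)).castSucc).1) -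
              (t (0 : Fin (M + 1)).castSucc - (b (0 : Fin (M + 1)).castSucc).1))
            ((z (0 : Fin (M + 1)).castSucc - (b (0 : Fin (M + 1)).castSucc).1) -
              (t (0 : Fin (M + 1)).castSucc - (b (0 : Fin (M + 1)).castSucc).1)) 0 *
          (Letters.perc d p).P (eq 1) (ge 0) (ge 1) (eq 1) (ge 0) (stepVec κ)
            (w (0 : Fin (M + 1)).succ - (b (0 : Fin (M + 1)).castSucc).1)
            (t (0 : Fin (M + 1)).castSucc - (b (0 : Fin (M + 1)).castSucc).1)
            (z (0 : Fin (M + 1)).castSucc - (b (0 : Fin (M + 1)).castSucc).1)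
            (w (0 : Fin (M + 1)).castSucc - (b (0 : Fin (M + 1)).castSucc).1)))) := by
  have he : (b (0 : Fin (M + 1)).castSucc).2 - (b (0 : Fin (M + 1)).castSucc).1 = stepVec κ := by
    rw [hb, add_sub_cancel_left]
  simp only [sub_sub_sub_cancel_right]
  rw [← he]
  exact nonempty_jPkg_firstE_properTZ_any_two p M x b w t z a c τ κ hb hσ hc1 ha ha' hty

/-- **Row `(1, ≥2 | d = 1)` of `B^{(2)}` at the FIRST junction behind `P^{S,1}`** (with its indicator
`2dD(w_0 − u_0)`, `= 1` on the piece by the exit class `1` of the start level): target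
`P^{S,1}(u_0,w_0) · (p⁻¹ · 2dD(w_0 − u_0) · 2dD(z_0 − t_0) · T_{≥1,≥1,1̲}(u_1 − t_0, z_0 − t_0, 0) · P_{1̲,≥0,≥1,1̲,≥0}(…))`.
[cite: FitznerVanDerHofstad2017, App. B Table "B^{(2),ι,a,b}", row a = 1, b ≥ 2, d_{C̃}(w,u) = 1 (arXiv:1506.07977v2 p. 76); §6.1 (6.7)–(6.8), "Case b = 1" (pp. 58–59); §5.1 (5.4) (p. 48)] -/
theorem nonempty_jPkg_firstE_properTZ_one_two (κ : Fin d × Bool)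
    (hb : (b (0 : Fin (M + 1)).castSucc).2 = (b (0 : Fin (M + 1)).castSucc).1 + stepVec κ) (hσ : (τ 0).1 = true)
    (hc1 : (τ 0).2 = 1) (ha : a (0 : Fin (M + 1)).castSucc = Sum.inl 1) {a' : Fin 3}
    (ha' : a (0 : Fin (M + 1)).succ = Sum.inl a') (hty : t (0 : Fin (M + 1)).castSucc ≠ (b (0 : Fin (M + 1)).succ).1) :
    Nonempty (JPkg p (jctx M x b w t z a τ (0 : Fin (M + 1)).castSucc) (JFacts M x b w t z a c τ)
      (blockPS (Letters.perc d p) 1 (b (0 : Fin (M + 1)).castSucc).1 (w (0 : Fin (M + 1)).castSucc) *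
        ((Letters.perc d p).p⁻¹ * twoDD (w (0 : Fin (M + 1)).castSucc - (b (0 : Fin (M + 1)).castSucc).1) *
            twoDD (z (0 : Fin (M + 1)).castSucc - t (0 : Fin (M + 1)).castSucc) *
          (Letters.perc d p).T (ge 1) (ge 1) (eq 1) ((b (0 : Fin (M + 1)).succ).1 - t (0 : Fin (M + 1)).castSucc)
            (z (0 : Fin (M + 1)).castSucc - t (0 : Fin (M + 1)).castSucc) 0 *
          (Letters.perc d p).P (eq 1) (ge 0) (ge 1) (eq 1) (ge 0)
            ((b (0 : Fin (M + 1)).castSucc).2 - (b (0 : Fin (M + 1)).castSucc).1)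
            (w (0 : Fin (M + 1)).succ - (b (0 : Fin (M + 1)).castSucc).1)
            (t (0 : Fin (M + 1)).castSucc - (b (0 : Fin (M + 1)).castSucc).1)
            (z (0 : Fin (M + 1)).castSucc - (b (0 : Fin (M + 1)).castSucc).1)
            (w (0 : Fin (M + 1)).castSucc - (b (0 : Fin (M + 1)).castSucc).1)))) := by
  -- degenerate parameters (`u_0 ≁ w_0`): the piece is empty
  by_cases hP : (zdGraph d).Adj (b (0 : Fin (M + 1)).castSucc).1 (w (0 : Fin (M + 1)).castSucc)
  swap
  · exact ⟨JPkg.vacuous p _ _ (fun ω K₀ hF => hP (hF.exitClass_one _ ha).2.2) _⟩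
  rw [twoDD_sub_eq_one_of_adj hP, mul_one]
  exact nonempty_jPkg_firstE_properTZ_any_two p M x b w t z a c τ κ hb hσ hc1 ha ha' hty

/-- **Row `(1, ≥2 | d = 1)` at the first junction in the literal base-`u_0` coordinates of
`NobleBlocksNTPrime.blockBNTpt₀'`** (first summand of the row `a = 1, b ≥ 2`), behind `P^{S,1}`:
`p⁻¹ · 2dD(v) · 2dD(z−t) · T_{≥1,≥1,1̲}(y−t, z−t, 0) · P_{1̲,≥0,≥1,1̲,≥0}(e_κ, x, t, z, v)`.
[cite: FitznerVanDerHofstad2017, App. B Table "B^{(2),ι,a,b}", row a = 1, b ≥ 2, d = 1 (arXiv:1506.07977v2 p. 76); §5.1 (5.4) (p. 48)] -/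
theorem nonempty_jPkg_firstE_properTZ_one_two_lit (κ : Fin d × Bool)
    (hb : (b (0 : Fin (M + 1)).castSucc).2 = (b (0 : Fin (M + 1)).castSucc).1 + stepVec κ) (hσ : (τ 0).1 = true)
    (hc1 : (τ 0).2 = 1) (ha : a (0 : Fin (M + 1)).castSucc = Sum.inl 1) {a' : Fin 3}
    (ha' : a (0 : Fin (M + 1)).succ = Sum.inl a') (hty : t (0 : Fin (M + 1)).castSucc ≠ (b (0 : Fin (M + 1)).succ).1) :
    Nonempty (JPkg p (jctx M x b w t z a τ (0 : Fin (M + 1)).castSucc) (JFacts M x b w t z a c τ)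
      (blockPS (Letters.perc d p) 1 (b (0 : Fin (M + 1)).castSucc).1 (w (0 : Fin (M + 1)).castSucc) *
        ((Letters.perc d p).p⁻¹ * twoDD (w (0 : Fin (M + 1)).castSucc - (b (0 : Fin (M + 1)).castSucc).1) *
            twoDD ((z (0 : Fin (M + 1)).castSucc - (b (0 : Fin (M + 1)).castSucc).1) -
              (t (0 : Fin (M + 1)).castSucc - (b (0 : Fin (M + 1)).castSucc).1)) *
          (Letters.perc d p).T (ge 1) (ge 1) (eq 1)
            (((b (0 : Fin (M + 1)).succ).1 - (b (0 : Fin (M + 1)).castSucc).1) -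
              (t (0 : Fin (M + 1)).castSucc - (b (0 : Fin (M + 1)).castSucc).1))
            ((z (0 : Fin (M + 1)).castSucc - (b (0 : Fin (M + 1)).castSucc).1) -
              (t (0 : Fin (M + 1)).castSucc - (b (0 : Fin (M + 1)).castSucc).1)) 0 *
          (Letters.perc d p).P (eq 1) (ge 0) (ge 1) (eq 1) (ge 0) (stepVec κ)
            (w (0 : Fin (M + 1)).succ - (b (0 : Fin (M + 1)).castSucc).1)
            (t (0 : Fin (M + 1)).castSucc - (b (0 : Fin (M + 1)).castSucc).1)
            (z (0 : Fin (M + 1)).castSucc - (b (0 : Fin (M + 1)).castSucc).1)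
            (w (0 : Fin (M + 1)).castSucc - (b (0 : Fin (M + 1)).castSucc).1)))) := by
  have he : (b (0 : Fin (M + 1)).castSucc).2 - (b (0 : Fin (M + 1)).castSucc).1 = stepVec κ := by
    rw [hb, add_sub_cancel_left]
  simp only [sub_sub_sub_cancel_right]
  rw [← he]
  exact nonempty_jPkg_firstE_properTZ_one_two p M x b w t z a c τ κ hb hσ hc1 ha ha' hty

/-- **Row `(0, ≥2 | d = 1)` of `B^{(2)}` at the FIRST junction behind `P^{S,0}`**: for `t_0 ≠ u_1` (`F″`), inner
class `1`, start class `0` (`w_0 = u_0`; the exit line `u_0 → z_0` of the start level has length `≥ 1`), a package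
with target `P^{S,0}(u_0,w_0) · (p⁻¹ · 2dD(z_0 − t_0) · T_{≥1,≥1,1̲}(u_1 − t_0, z_0 − t_0, 0) ·
P_{1̲,≥0,≥1,1̲,≥1}(b̄_0 − u_0, w_1 − u_0, t_0 − u_0, z_0 − u_0, 0))`; `a_1 ≤ 1`: empty piece.
[cite: FitznerVanDerHofstad2017, App. B Table "B^{(2),ι,a,b}", row a = 0, b ≥ 2, d_{C̃}(w,u) = 1 (arXiv:1506.07977v2 p. 76); §6.1 (6.5)–(6.6), "Case b = 1" (pp. 58–59); §5.1 (5.4) (p. 48)] -/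
theorem nonempty_jPkg_firstE_properTZ_zero_two (κ : Fin d × Bool)
    (hb : (b (0 : Fin (M + 1)).castSucc).2 = (b (0 : Fin (M + 1)).castSucc).1 + stepVec κ) (hσ : (τ 0).1 = true)
    (hc1 : (τ 0).2 = 1) (ha : a (0 : Fin (M + 1)).castSucc = Sum.inl 0) {a' : Fin 3}
    (ha' : a (0 : Fin (M + 1)).succ = Sum.inl a') (hty : t (0 : Fin (M + 1)).castSucc ≠ (b (0 : Fin (M + 1)).succ).1) :
    Nonempty (JPkg p (jctx M x b w t z a τ (0 : Fin (M + 1)).castSucc) (JFacts M x b w t z a c τ)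
      (blockPS (Letters.perc d p) 0 (b (0 : Fin (M + 1)).castSucc).1 (w (0 : Fin (M + 1)).castSucc) *
        ((Letters.perc d p).p⁻¹ * twoDD (z (0 : Fin (M + 1)).castSucc - t (0 : Fin (M + 1)).castSucc) *
          (Letters.perc d p).T (ge 1) (ge 1) (eq 1) ((b (0 : Fin (M + 1)).succ).1 - t (0 : Fin (M + 1)).castSucc)
            (z (0 : Fin (M + 1)).castSucc - t (0 : Fin (M + 1)).castSucc) 0 *
          (Letters.perc d p).P (eq 1) (ge 0) (ge 1) (eq 1) (ge 1)
            ((b (0 : Fin (M + 1)).castSucc).2 - (b (0 : Fin (M + 1)).castSucc).1)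
            (w (0 : Fin (M + 1)).succ - (b (0 : Fin (M + 1)).castSucc).1)
            (t (0 : Fin (M + 1)).castSucc - (b (0 : Fin (M + 1)).castSucc).1)
            (z (0 : Fin (M + 1)).castSucc - (b (0 : Fin (M + 1)).castSucc).1) 0))) := by
  -- exit class `a′ ≤ 1` above: the piece is empty (clause (8))
  by_cases h2 : a' = 2
  swap
  · exact nonempty_jPkg_of_sharp p c _ 0 hσ ha' h2 hty _
  subst h2
  -- degenerate parameters: the piece is empty
  by_cases hP : z (0 : Fin (M + 1)).castSucc ≠ (b (0 : Fin (M + 1)).succ).1 ∧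
      w (0 : Fin (M + 1)).succ ≠ t (0 : Fin (M + 1)).castSucc ∧
      t (0 : Fin (M + 1)).castSucc ≠ z (0 : Fin (M + 1)).castSucc ∧
      (zdGraph d).Adj (t (0 : Fin (M + 1)).castSucc) (z (0 : Fin (M + 1)).castSucc) ∧
      (b (0 : Fin (M + 1)).castSucc).1 ≠ z (0 : Fin (M + 1)).castSucc ∧
      ((b (0 : Fin (M + 1)).castSucc).1 = 0 → w (0 : Fin (M + 1)).castSucc = 0) ∧
      w (0 : Fin (M + 1)).castSucc = (b (0 : Fin (M + 1)).castSucc).1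
  swap
  · refine ⟨JPkg.vacuous p _ _ (fun ω K₀ hF => hP ?_) _⟩
    obtain ⟨⟨-, hzy, hwt, -, -, huz, -, hcan, hw0, -, -⟩, htz, hadj, -⟩ :=
      firstEProperTZ_facts M x b w t z a c τ hF hσ ha ha' hty hc1
    exact ⟨hzy, hwt, htz, hadj, huz, hcan, hw0 rfl⟩
  obtain ⟨hzy, hwt, htz, hadj, huz, hcan, hwu⟩ := hP
  have huv : (b (0 : Fin (M + 1)).castSucc).1 ≠ (b (0 : Fin (M + 1)).castSucc).2 := by
    rw [hb]; exact (zdGraph_adj_iff_stepVec _ _ |>.2 ⟨κ, rfl⟩).ne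
  have he : s((b (0 : Fin (M + 1)).castSucc).1, (b (0 : Fin (M + 1)).castSucc).2) ∈ (zdGraph d).edgeSet :=
    (SimpleGraph.mem_edgeSet _).2 ((zdGraph_adj_iff_stepVec _ _).2 ⟨κ, hb⟩)
  obtain ⟨X0, X1, X2, f0, f1, f2, hmem₀, hrow₀⟩ :=
    first_startLetter_gl p M x b w t z a c τ glFirstPT true true (.lo 0) rfl rfl rfl ha hcan (fun _ => hwu)
      (fun h => absurd h (by decide)) (fun h => absurd h (by decide))
  rw [twoDD_sub_eq_one_of_adj hadj, mul_one, perc_p]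
  have h := nonempty_jPkg_firstEPT_core p M x b w t z a c τ hσ hc1 ha' X0 X1 X2
    (event (ge 1) (z (0 : Fin (M + 1)).castSucc) (b (0 : Fin (M + 1)).castSucc).1)
    (event (ge 0) (b (0 : Fin (M + 1)).castSucc).2 (w (0 : Fin (M + 1)).succ))
    (event (ge 1) (w (0 : Fin (M + 1)).succ) (t (0 : Fin (M + 1)).castSucc))
    (event (eq 1) (z (0 : Fin (M + 1)).castSucc) (t (0 : Fin (M + 1)).castSucc))
    (event (ge 1) (t (0 : Fin (M + 1)).castSucc) (b (0 : Fin (M + 1)).succ).1)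
    (event (ge 1) (b (0 : Fin (M + 1)).succ).1 (z (0 : Fin (M + 1)).castSucc))
    f0 f1 f2 (isFinitary_event _ _ _) (isFinitary_event _ _ _) (isFinitary_event _ _ _) (isFinitary_event _ _ _)
    (isFinitary_event _ _ _) (isFinitary_event _ _ _)
    (singleton_mem_event_eq_one huv) (singleton_mem_event_eq_one htz) he (fun ω K₀ hF => ?_)
    (hrow₀ _ rfl rfl rfl)
    (Y₁ := (Letters.perc d p).P (eq 1) (ge 0) (ge 1) (eq 1) (ge 1)
      ((b (0 : Fin (M + 1)).castSucc).2 - (b (0 : Fin (M + 1)).castSucc).1)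
      (w (0 : Fin (M + 1)).succ - (b (0 : Fin (M + 1)).castSucc).1)
      (t (0 : Fin (M + 1)).castSucc - (b (0 : Fin (M + 1)).castSucc).1)
      (z (0 : Fin (M + 1)).castSucc - (b (0 : Fin (M + 1)).castSucc).1) 0)
    (Y₂ := (Letters.perc d p).T (ge 1) (ge 1) (eq 1) ((b (0 : Fin (M + 1)).succ).1 - t (0 : Fin (M + 1)).castSucc)
      (z (0 : Fin (M + 1)).castSucc - t (0 : Fin (M + 1)).castSucc) 0)
    ?_ ?_
  · exact h
  · obtain ⟨h0, h1, -, h3, h4⟩ := hF.conn_midE 0 hσ ha'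
    obtain ⟨-, htz', -, hop⟩ := firstEProperTZ_facts M x b w t z a c τ hF hσ ha ha' hty hc1
    obtain ⟨-, -, h5⟩ := hF.conn_first
    rw [hwu] at h5
    refine ⟨(hmem₀ ω K₀ hF).1, (hmem₀ ω K₀ hF).2.1, (hmem₀ ω K₀ hF).2.2, ?_, ?_, ?_, ?_, ?_, ?_⟩
    · rw [event_comm, event_ge]; exact mem_openConnGe_one_of_ne h5 huz
    · rw [event_ge]; exact mem_openConnGe_zero_of_mem h0
    · rw [event_ge]; exact mem_openConnGe_one_of_ne h1 hwt
    · rw [hF.tz_witness_midE 0 hσ ha' htz' hop, event_comm]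
      exact singleton_mem_event_eq_one htz'
    · rw [event_ge]; exact mem_openConnGe_one_of_ne h3 hty
    · rw [event_comm, event_ge]; exact mem_openConnGe_one_of_ne h4 hzy
  · have hP' := piPerc_genDisjOcc_le_P p (eq 1) (ge 0) (ge 1) (eq 1) (ge 1) (b (0 : Fin (M + 1)).castSucc).1
      (b (0 : Fin (M + 1)).castSucc).2 (w (0 : Fin (M + 1)).succ) (t (0 : Fin (M + 1)).castSucc)
      (z (0 : Fin (M + 1)).castSucc) (b (0 : Fin (M + 1)).castSucc).1 (![0, 1, 1, 0, 0] : Fin 5 → Fin 2)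
    rwa [sub_self] at hP'
  · have hT' := piPerc_genDisjOcc_le_T p (ge 1) (ge 1) (eq 1) (t (0 : Fin (M + 1)).castSucc)
      (b (0 : Fin (M + 1)).succ).1 (z (0 : Fin (M + 1)).castSucc) (t (0 : Fin (M + 1)).castSucc)
      (![1, 1, 1] : Fin 3 → Fin 2)
    rwa [sub_self] at hT'

/-- **Row `(0, ≥2 | d = 1)` at the first junction in the literal base-`u_0` coordinates of
`NobleBlocksNTPrime.blockBNTpt₀'`** (first summand of `blockBNTpt₀'_zero_two` with its prefactors
`δ_{v,0} (1−δ_{v,z})`), behind `P^{S,0}`.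
[cite: FitznerVanDerHofstad2017, App. B Table "B^{(2),ι,a,b}", row a = 0, b ≥ 2, d = 1 (arXiv:1506.07977v2 p. 76); §5.1 (5.4) (p. 48)] -/
theorem nonempty_jPkg_firstE_properTZ_zero_two_lit (κ : Fin d × Bool)
    (hb : (b (0 : Fin (M + 1)).castSucc).2 = (b (0 : Fin (M + 1)).castSucc).1 + stepVec κ) (hσ : (τ 0).1 = true)
    (hc1 : (τ 0).2 = 1) (ha : a (0 : Fin (M + 1)).castSucc = Sum.inl 0) {a' : Fin 3}
    (ha' : a (0 : Fin (M + 1)).succ = Sum.inl a') (hty : t (0 : Fin (M + 1)).castSucc ≠ (b (0 : Fin (M + 1)).succ).1) :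
    Nonempty (JPkg p (jctx M x b w t z a τ (0 : Fin (M + 1)).castSucc) (JFacts M x b w t z a c τ)
      (blockPS (Letters.perc d p) 0 (b (0 : Fin (M + 1)).castSucc).1 (w (0 : Fin (M + 1)).castSucc) *
        (kd (w (0 : Fin (M + 1)).castSucc - (b (0 : Fin (M + 1)).castSucc).1) 0 *
          (kdc (w (0 : Fin (M + 1)).castSucc - (b (0 : Fin (M + 1)).castSucc).1)
              (z (0 : Fin (M + 1)).castSucc - (b (0 : Fin (M + 1)).castSucc).1) *
            ((Letters.perc d p).p⁻¹ *
                twoDD ((z (0 : Fin (M + 1)).castSucc - (b (0 : Fin (M + 1)).castSucc).1) -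
                  (t (0 : Fin (M + 1)).castSucc - (b (0 : Fin (M + 1)).castSucc).1)) *
              (Letters.perc d p).T (ge 1) (ge 1) (eq 1)
                (((b (0 : Fin (M + 1)).succ).1 - (b (0 : Fin (M + 1)).castSucc).1) -
                  (t (0 : Fin (M + 1)).castSucc - (b (0 : Fin (M + 1)).castSucc).1))
                ((z (0 : Fin (M + 1)).castSucc - (b (0 : Fin (M + 1)).castSucc).1) -
                  (t (0 : Fin (M + 1)).castSucc - (b (0 : Fin (M + 1)).castSucc).1)) 0 *
              (Letters.perc d p).P (eq 1) (ge 0) (ge 1) (eq 1) (ge 1) (stepVec κ)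
                (w (0 : Fin (M + 1)).succ - (b (0 : Fin (M + 1)).castSucc).1)
                (t (0 : Fin (M + 1)).castSucc - (b (0 : Fin (M + 1)).castSucc).1)
                (z (0 : Fin (M + 1)).castSucc - (b (0 : Fin (M + 1)).castSucc).1) 0))))) := by
  have he : (b (0 : Fin (M + 1)).castSucc).2 - (b (0 : Fin (M + 1)).castSucc).1 = stepVec κ := by
    rw [hb, add_sub_cancel_left]
  -- degenerate parameters (`w_0 ≠ u_0` or `z_0 = u_0`): the piece is empty and the prefactors may vanish
  by_cases hwu : w (0 : Fin (M + 1)).castSucc = (b (0 : Fin (M + 1)).castSucc).1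
  swap
  · rw [kd_of_ne (sub_ne_zero.2 hwu), zero_mul, mul_zero]
    exact ⟨JPkg.vacuous p _ _ (fun ω K₀ hF => hwu (hF.w_eq_of_exitClass_zero _ ha)) _⟩
  by_cases huz : (b (0 : Fin (M + 1)).castSucc).1 = z (0 : Fin (M + 1)).castSucc
  · rw [hwu, huz, kdc_self, zero_mul, mul_zero]
    refine ⟨JPkg.vacuous p _ _ (fun ω K₀ hF => ?_) _⟩
    obtain ⟨⟨-, -, -, -, -, huz', -⟩, -⟩ := firstEProperTZ_facts M x b w t z a c τ hF hσ ha ha' hty hc1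
    exact huz' huz
  have hvz : w (0 : Fin (M + 1)).castSucc - (b (0 : Fin (M + 1)).castSucc).1 ≠
      z (0 : Fin (M + 1)).castSucc - (b (0 : Fin (M + 1)).castSucc).1 := by
    rw [hwu]; exact fun h => huz (sub_left_injective h)
  rw [kdc_of_ne hvz, hwu, sub_self, kd_self, one_mul, one_mul]
  simp only [sub_sub_sub_cancel_right]
  rw [← he]
  have h := nonempty_jPkg_firstE_properTZ_zero_two p M x b w t z a c τ κ hb hσ hc1 ha ha' hty
  rw [hwu] at h
  exact h

end Packages

end Literature.Probability.FitznerVanDerHofstad2017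

end
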